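import Literature.AnabelianGeometry.EtaleTheta.Discharge.Sec1EllPowersSeparated
import Literature.AnabelianGeometry.EtaleTheta.Discharge.Sec1DeltaThetaTateTwist
import HarnessLib

/-!
# [EtTh] §1: at a joint origin the Galois sections of a cusp act on (the `Θ`-image of) its inertia through the
# CYCLOTOMIC CHARACTER modulo every `N` — «`I_x ≅ Ẑ(1)`» as a Galois module, derived from the Tate-module clause

Mochizuki, *The étale theta function and its Frobenioid-theoretic manifestations*, Publ. RIMS **45** (2009) [EtTh],
§1, kurims PDF p. 12 «`(Ẑ(1) ≅) Δ_Θ ⊆ Δ^Θ_X`», p. 13 «`(Δ^tp_Y)^ell ≅ Ẑ(1)`», Def. 2.1 p. 35 «a natural injective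
[outer] homomorphism `D_x → Π^Θ_X` … which maps the inertia group `I_x ⊆ D_x` isomorphically onto `Δ_Θ`. Thus, we
have exact sequences … `1 → Δ_Θ → D̄_x → G_K → 1`» [cite: MochizukiEtTh2009, Def 2.1 p.35]; [SemiAnbd] §6 p. 71
«`I_x` is isomorphic to `Ẑ(1)` if `x` is a cusp» [cite: MochizukiSemiAnbd2006, §6 p.71].  abc-iut cell, layer L2,
seat abc-iut-w5-d051 (gen 4; NV / §1-interface lane); PROOF-ONLY sequel of `Sec1EllPowersSeparated.lean` (p451482)
over abc-iut-w5-d187's `Sec1DeltaThetaTateTwist.lean` (the Tate twist of `Δ_Θ` from that of `(Δ^tp_Y)^ell`).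

WHAT.  The typed interface records `I_x ≅ Ẑ` ABSTRACTLY (`TemperedCurve.inertia_equiv_zHat`) and says nothing about
the Galois-module structure «`(1)`».  At a `D : ThetaSetting p` carrying the guard `IsEtThOrigin`, the closedness
binder `hYcl` (GAP row G-w4d021-2), the Tate-module clause `IsTateOrigin` (clauses (a) and (b) at level `N`) and the
printed construction of `Y_N` (R2, `Thm16Sub.GtpYNFromCusp`, for every `N`) we PROVE, for every level `N`:

* `ThetaSetting.IsTateOrigin.exists_primitiveRoot_conj_deltaTheta` /
  **`ThetaSetting.IsTateOrigin.conj_deltaTheta_tateTwist`** — «`Δ_Θ ≅ Ẑ(1)`» MOD `N` as a standalone law: for EVERY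
  primitive `N`-th root of unity `ζ`, every `σ ∈ Π^tp_X` with `aug(σ) ζ = ζ^k`, and every `s ∈ Δ_Θ`:
  `θ(σ) s θ(σ)⁻¹ = e^N · s^k` with `e ∈ Δ_Θ` (abc-iut-w5-d187's `exists_conj_commutator_eq_pow_mul_pow` for the
  generator `θ[z,y₁]` — clause (b) — spread over `Δ_Θ = θ[z,y₁]^ℕ · Δ_Θ^N` — clause (a),
  `exists_eq_pow_mul_commutator_pow` — by the commutativity of `Δ_Θ`, root field `ker_thetaToEll_comm`);
* **`ThetaSetting.IsTateOrigin.conj_inertia_tateTwist`** — hence, for EVERY cuspidal decomposition group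
  `Dc ⊆ Π^tp_Y` and every `w ∈ Dc ∩ Δ^tp_X`: `θ(σ w σ⁻¹) = e^N · θ(w)^k` with `e ∈ Δ_Θ` — because
  `θ(Dc ∩ Δ^tp_X) ⊆ Δ_Θ` (p451482 `IsTateOrigin.map_toTheta_inertia_le_deltaTheta`): the inertia of a cusp of `Y`
  is a `Ẑ(1)` MODULO EVERY `N` in the theta quotient, for the conjugation action of ALL of `Π^tp_X` (in particular of
  the cusp's own decomposition group);
* the joint-origin forms `conj_deltaTheta_tateTwist_of_origins` / `conj_inertia_tateTwist_of_origins`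
  (`IsThm16Origin ∧ IsTateOrigin`), and the CENTRALISER consequence `ThetaSetting.IsTateOrigin.pow_eq_pow_mul_of_centralises`:
  an element `σ` CENTRALISING a cusp-inertia element `w` has `θ(w) = e^N · θ(w)^k` (`e ∈ Δ_Θ`) whenever `aug(σ) ζ_N = ζ_N^k`
  — the interface form of the input «`χ(d.right) = ±1`» of abc-iut-w5-d165's model-side obstructions
  (`SettingModelChiTwistCuspObstruction`, `SettingModelTateNoCommAxisCusp`): a section that fixes its cusp
  inertia pointwise sees only the trivial character on `θ(w)` modulo `N`.

PROOF-ONLY: no definition, no instance, no named fact; nothing of another seat's file restated.  HONEST FRAMING: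
interface law over the frozen root; the origin predicates and `hYcl` are hypotheses inhabited only at models; nothing
of [EtTh]/[SemiAnbd] is asserted for genuine tempered fundamental groups; no side is taken on [IUTchIII] Cor. 3.12;
typed ≠ proved.
-/

noncomputable section

namespace Literature.AnabelianGeometry.EtaleTheta

open Literature.AnabelianGeometry.SemiGraphs Thm16Sub
open scoped Pointwise

namespace ThetaSetting

variable {p : ℕ} [Fact p.Prime] {D : ThetaSetting p}

/-! ### 1. Commutative bookkeeping in `Δ_Θ` -/

/-- The algebra of the Tate twist inside the commutative group `Δ_Θ`: from `t·c·t⁻¹`-data `T c₀ T⁻¹ = e^N c₀^k` (on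
the generator) and `s = e'^N c₀^m`, the conjugate `t^N (e^N c₀^k)^m` of `s` (with `t = T e' T⁻¹`) is `E^N s^k` for
`E := t e^m (e'^k)⁻¹`. Pure commutative-group identity. [folklore] -/
private theorem tateTwist_algebra {t e c₀ e' : D.GtpTheta} (ht : t ∈ D.DeltaTheta) (he : e ∈ D.DeltaTheta)
    (hc₀ : c₀ ∈ D.DeltaTheta) (he' : e' ∈ D.DeltaTheta) (N m k : ℕ) :
    t ^ N * (e ^ N * c₀ ^ k) ^ m =
      (t * e ^ m * (e' ^ k)⁻¹) ^ N * (e' ^ N * c₀ ^ m) ^ k := by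
  -- move to the subgroup `Δ_Θ`, which is commutative (root field `ker_thetaToEll_comm`)
  letI : CommGroup ↥D.DeltaTheta :=
    { (inferInstance : Group ↥D.DeltaTheta) with
      mul_comm := fun a b => Subtype.ext (D.ker_thetaToEll_comm _ a.2 _ b.2) }
  have key : ((⟨t, ht⟩ : ↥D.DeltaTheta) ^ N * ((⟨e, he⟩ : ↥D.DeltaTheta) ^ N * (⟨c₀, hc₀⟩ : ↥D.DeltaTheta) ^ k) ^ m) =
      ((⟨t, ht⟩ : ↥D.DeltaTheta) * (⟨e, he⟩ : ↥D.DeltaTheta) ^ m * (((⟨e', he'⟩ : ↥D.DeltaTheta) ^ k)⁻¹)) ^ N *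
        ((⟨e', he'⟩ : ↥D.DeltaTheta) ^ N * (⟨c₀, hc₀⟩ : ↥D.DeltaTheta) ^ m) ^ k := by
    simp only [mul_pow, inv_pow, ← pow_mul]
    rw [mul_comm k N, mul_comm k m, mul_comm m N]
    -- now both sides are products of the same powers up to the cancelling pair `e'^(Nk)`
    have hcancel : ((⟨e', he'⟩ : ↥D.DeltaTheta) ^ (N * k))⁻¹ * (⟨e', he'⟩ : ↥D.DeltaTheta) ^ (N * k) = 1 :=
      inv_mul_cancel _
    calc (⟨t, ht⟩ : ↥D.DeltaTheta) ^ N * ((⟨e, he⟩ : ↥D.DeltaTheta) ^ (N * m) * (⟨c₀, hc₀⟩ : ↥D.DeltaTheta) ^ (m * k))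
        = (⟨t, ht⟩ : ↥D.DeltaTheta) ^ N * (⟨e, he⟩ : ↥D.DeltaTheta) ^ (N * m) *
            ((((⟨e', he'⟩ : ↥D.DeltaTheta) ^ (N * k))⁻¹ * (⟨e', he'⟩ : ↥D.DeltaTheta) ^ (N * k)) *
              (⟨c₀, hc₀⟩ : ↥D.DeltaTheta) ^ (m * k)) := by rw [hcancel, one_mul, mul_assoc]
      _ = (⟨t, ht⟩ : ↥D.DeltaTheta) ^ N * (⟨e, he⟩ : ↥D.DeltaTheta) ^ (N * m) *
            ((⟨e', he'⟩ : ↥D.DeltaTheta) ^ (N * k))⁻¹ *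
              ((⟨e', he'⟩ : ↥D.DeltaTheta) ^ (N * k) * (⟨c₀, hc₀⟩ : ↥D.DeltaTheta) ^ (m * k)) := by
          simp only [mul_assoc]
  have := congrArg (fun a : ↥D.DeltaTheta => (a : D.GtpTheta)) key
  simpa only [Subgroup.coe_mul, Subgroup.coe_pow, Subgroup.coe_inv, Subgroup.coe_mk] using this

/-! ### 2. «`Δ_Θ ≅ Ẑ(1)`» modulo `N` from the Tate-module clause -/

/-- **«`Δ_Θ ≅ Ẑ(1)`» mod `N`, at the clause's own primitive root**: at `IsEtThOrigin` + `hYcl` + `IsTateOrigin` there is,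
for every `N`, a primitive `N`-th root of unity `ζ` such that every `σ ∈ Π^tp_X` with `aug(σ) ζ = ζ^k` conjugates every
`s ∈ Δ_Θ` to `e^N · s^k` with `e ∈ Δ_Θ` (clause (b) on the generator `θ[z,y₁]` via abc-iut-w5-d187's
`exists_conj_commutator_eq_pow_mul_pow`, clause (a) via `exists_eq_pow_mul_commutator_pow`).
[cite: MochizukiEtTh2009, §1 p.12] -/
theorem IsTateOrigin.exists_primitiveRoot_conj_deltaTheta (hO : D.IsEtThOrigin)
    (hYcl : (D.DtpY.map D.toHat.toMonoidHom).topologicalClosure ≤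
      D.DtpY.map D.toHat.toMonoidHom ⊔ (⁅⁅D.DeltaHat, D.DeltaHat⁆, D.DeltaHat⁆).topologicalClosure)
    (hT : D.IsTateOrigin) (N : ℕ+) :
    ∃ ζ : PadicAlgCl p, IsPrimitiveRoot ζ (N : ℕ) ∧
      ∀ (σ : D.PiTemp) (k : ℕ), D.aug σ ζ = ζ ^ k →
        ∀ s ∈ D.DeltaTheta, ∃ e ∈ D.DeltaTheta,
          D.toTheta σ * s * (D.toTheta σ)⁻¹ = e ^ (N : ℕ) * s ^ k := by
  obtain ⟨y₁, z, ζ, -, hy₁, hz, hzZ, hζ, -, ha, -, hb, -⟩ := hT.tate N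
  refine ⟨ζ, hζ, fun σ k hσ s hs => ?_⟩
  haveI : D.DeltaTheta.Normal := inferInstanceAs D.thetaToEll.ker.Normal
  -- the generator `c₀ = θ[z,y₁]` and its conjugate
  obtain ⟨e, he, hconj⟩ := D.exists_conj_commutator_eq_pow_mul_pow hO hz hy₁ σ (hb σ k hσ y₁ hy₁)
  -- `s = e'^N c₀^m`
  obtain ⟨e', he', m, hs_eq⟩ := D.exists_eq_pow_mul_commutator_pow hO hYcl hz hzZ hy₁ ha hs
  have hc₀ : D.toTheta (z * y₁ * z⁻¹ * y₁⁻¹) ∈ D.DeltaTheta := D.toTheta_commutator_mem_deltaTheta hz hy₁.2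
  have ht : D.toTheta σ * e' * (D.toTheta σ)⁻¹ ∈ D.DeltaTheta :=
    (inferInstance : D.DeltaTheta.Normal).conj_mem e' he' (D.toTheta σ)
  refine ⟨D.toTheta σ * e' * (D.toTheta σ)⁻¹ * e ^ m * (e' ^ k)⁻¹,
    mul_mem (mul_mem ht (pow_mem he m)) (inv_mem (pow_mem he' k)), ?_⟩
  -- conjugation is a homomorphism
  have hhom : D.toTheta σ * s * (D.toTheta σ)⁻¹ =
      (D.toTheta σ * e' * (D.toTheta σ)⁻¹) ^ (N : ℕ) *
        (D.toTheta σ * D.toTheta (z * y₁ * z⁻¹ * y₁⁻¹) * (D.toTheta σ)⁻¹) ^ m := by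
    rw [hs_eq, ← MulAut.conj_apply, map_mul, map_pow, map_pow, MulAut.conj_apply, MulAut.conj_apply]
  rw [hhom, hconj, hs_eq]
  exact tateTwist_algebra ht he hc₀ he' N m k

/-- **«`Δ_Θ ≅ Ẑ(1)`» mod `N`, for EVERY primitive `N`-th root of unity** (the character value `k` of `σ` read on any
primitive root is the same). [cite: MochizukiEtTh2009, §1 p.12] -/
theorem IsTateOrigin.conj_deltaTheta_tateTwist (hO : D.IsEtThOrigin)
    (hYcl : (D.DtpY.map D.toHat.toMonoidHom).topologicalClosure ≤
      D.DtpY.map D.toHat.toMonoidHom ⊔ (⁅⁅D.DeltaHat, D.DeltaHat⁆, D.DeltaHat⁆).topologicalClosure)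
    (hT : D.IsTateOrigin) (N : ℕ+) {ζ : PadicAlgCl p} (hζ : IsPrimitiveRoot ζ (N : ℕ))
    (σ : D.PiTemp) {k : ℕ} (hσ : D.aug σ ζ = ζ ^ k) {s : D.GtpTheta} (hs : s ∈ D.DeltaTheta) :
    ∃ e ∈ D.DeltaTheta, D.toTheta σ * s * (D.toTheta σ)⁻¹ = e ^ (N : ℕ) * s ^ k := by
  obtain ⟨ζ₀, hζ₀, H⟩ := hT.exists_primitiveRoot_conj_deltaTheta hO hYcl N
  -- `ζ₀ = ζ^j`, so `aug(σ) ζ₀ = ζ₀^k` as well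
  obtain ⟨j, -, hj⟩ := hζ.eq_pow_of_pow_eq_one hζ₀.pow_eq_one
  have hσ₀ : D.aug σ ζ₀ = ζ₀ ^ k := by
    rw [← hj, map_pow, hσ, ← pow_mul, mul_comm, pow_mul]
  exact H σ k hσ₀ s hs

/-! ### 3. The cusp inertia is a `Ẑ(1)` modulo every `N` in the theta quotient -/

/-- **At `IsTateOrigin` + R2 (every `N`): the conjugation action of `Π^tp_X` on the `Θ`-image of the inertia of every
cusp of `Y` is the cyclotomic character mod `N`** — for `Dc ⊆ Π^tp_Y` cuspidal, `w ∈ Dc ∩ Δ^tp_X`, a primitive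
`N`-th root `ζ` and `σ ∈ Π^tp_X` with `aug(σ) ζ = ζ^k`: `θ(σ w σ⁻¹) = e^N · θ(w)^k`, `e ∈ Δ_Θ` («`I_x ≅ Ẑ(1)`»,
[SemiAnbd] §6 p. 71, read in `Π^Θ_X` where «`D_x → Π^Θ_X` maps `I_x` onto `Δ_Θ ≅ Ẑ(1)`», Def. 2.1 p. 35).
[cite: MochizukiEtTh2009, Def 2.1 p.35] -/
theorem IsTateOrigin.conj_inertia_tateTwist (hO : D.IsEtThOrigin)
    (hYcl : (D.DtpY.map D.toHat.toMonoidHom).topologicalClosure ≤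
      D.DtpY.map D.toHat.toMonoidHom ⊔ (⁅⁅D.DeltaHat, D.DeltaHat⁆, D.DeltaHat⁆).topologicalClosure)
    (hT : D.IsTateOrigin) (hR2 : ∀ N : ℕ+, GtpYNFromCusp D N) {Dc : Subgroup D.PiTemp}
    (hDc : D.IsCuspidalDecompositionGroup Dc) (hDcY : Dc ≤ D.GtpY) (N : ℕ+) {ζ : PadicAlgCl p}
    (hζ : IsPrimitiveRoot ζ (N : ℕ)) (σ : D.PiTemp) {k : ℕ} (hσ : D.aug σ ζ = ζ ^ k)
    {w : D.PiTemp} (hw : w ∈ Dc ⊓ D.DeltaTemp) :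
    ∃ e ∈ D.DeltaTheta, D.toTheta (σ * w * σ⁻¹) = e ^ (N : ℕ) * D.toTheta w ^ k := by
  have hwΘ : D.toTheta w ∈ D.DeltaTheta := hT.map_toTheta_inertia_le_deltaTheta hR2 hDc hDcY ⟨w, hw, rfl⟩
  obtain ⟨e, he, h⟩ := hT.conj_deltaTheta_tateTwist hO hYcl N hζ σ hσ hwΘ
  exact ⟨e, he, by rw [map_mul, map_mul, map_inv, h]⟩

/-- **Joint-origin form** (`IsThm16Origin ∧ IsTateOrigin`): «`Δ_Θ ≅ Ẑ(1)`» mod `N`.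
[cite: MochizukiEtTh2009, §1 p.12] -/
theorem conj_deltaTheta_tateTwist_of_origins (hO : D.IsEtThOrigin)
    (hYcl : (D.DtpY.map D.toHat.toMonoidHom).topologicalClosure ≤
      D.DtpY.map D.toHat.toMonoidHom ⊔ (⁅⁅D.DeltaHat, D.DeltaHat⁆, D.DeltaHat⁆).topologicalClosure)
    (_h16 : D.IsThm16Origin) (hT : D.IsTateOrigin) (N : ℕ+) {ζ : PadicAlgCl p}
    (hζ : IsPrimitiveRoot ζ (N : ℕ)) (σ : D.PiTemp) {k : ℕ} (hσ : D.aug σ ζ = ζ ^ k) {s : D.GtpTheta}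
    (hs : s ∈ D.DeltaTheta) :
    ∃ e ∈ D.DeltaTheta, D.toTheta σ * s * (D.toTheta σ)⁻¹ = e ^ (N : ℕ) * s ^ k :=
  hT.conj_deltaTheta_tateTwist hO hYcl N hζ σ hσ hs

/-- **Joint-origin form** (`IsThm16Origin ∧ IsTateOrigin`; R2 from `IsThm16Origin`): the inertia of every cusp of `Y`
is a `Ẑ(1)` modulo every `N` in `(Π^tp_X)^Θ`. [cite: MochizukiEtTh2009, Def 2.1 p.35] -/
theorem conj_inertia_tateTwist_of_origins (hO : D.IsEtThOrigin)
    (hYcl : (D.DtpY.map D.toHat.toMonoidHom).topologicalClosure ≤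
      D.DtpY.map D.toHat.toMonoidHom ⊔ (⁅⁅D.DeltaHat, D.DeltaHat⁆, D.DeltaHat⁆).topologicalClosure)
    (h16 : D.IsThm16Origin) (hT : D.IsTateOrigin) {Dc : Subgroup D.PiTemp}
    (hDc : D.IsCuspidalDecompositionGroup Dc) (hDcY : Dc ≤ D.GtpY) (N : ℕ+) {ζ : PadicAlgCl p}
    (hζ : IsPrimitiveRoot ζ (N : ℕ)) (σ : D.PiTemp) {k : ℕ} (hσ : D.aug σ ζ = ζ ^ k)
    {w : D.PiTemp} (hw : w ∈ Dc ⊓ D.DeltaTemp) :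
    ∃ e ∈ D.DeltaTheta, D.toTheta (σ * w * σ⁻¹) = e ^ (N : ℕ) * D.toTheta w ^ k :=
  hT.conj_inertia_tateTwist hO hYcl h16.gtpYN_fromCusp hDc hDcY N hζ σ hσ hw

/-- **The representative form** for a cusp `x` with `D_x ⊆ Π^tp_Y` (parameter (P3) of abc-iut-L2-t7's
`OncePuncturedData`): `I_x = D_x ∩ Δ^tp_X` is a `Ẑ(1)` mod `N` in `(Π^tp_X)^Θ` at a joint origin.
[cite: MochizukiEtTh2009, Def 2.1 p.35] -/
theorem conj_inertia_tateTwist_of_origins_of_isCusp (hO : D.IsEtThOrigin)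
    (hYcl : (D.DtpY.map D.toHat.toMonoidHom).topologicalClosure ≤
      D.DtpY.map D.toHat.toMonoidHom ⊔ (⁅⁅D.DeltaHat, D.DeltaHat⁆, D.DeltaHat⁆).topologicalClosure)
    (h16 : D.IsThm16Origin) (hT : D.IsTateOrigin) {x : D.Pt} (hx : D.IsCusp x) (hP3 : D.decomp x ≤ D.GtpY)
    (N : ℕ+) {ζ : PadicAlgCl p} (hζ : IsPrimitiveRoot ζ (N : ℕ)) (σ : D.PiTemp) {k : ℕ}
    (hσ : D.aug σ ζ = ζ ^ k) {w : D.PiTemp} (hw : w ∈ D.inertia x) :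
    ∃ e ∈ D.DeltaTheta, D.toTheta (σ * w * σ⁻¹) = e ^ (N : ℕ) * D.toTheta w ^ k :=
  D.conj_inertia_tateTwist_of_origins hO hYcl h16 hT ⟨x, hx, 1, (one_smul _ _).symm⟩ hP3 N hζ σ hσ hw

/-! ### 4. Centralisers see the trivial character -/

/-- **An element centralising a cusp-inertia element sees the trivial character on it modulo `N`**: if
`σ w σ⁻¹ = w` for `w ∈ Dc ∩ Δ^tp_X` and `aug(σ) ζ_N = ζ_N^k`, then `θ(w)^k = e^N · θ(w)` with `e ∈ Δ_Θ`, i.e. `θ(w)^k`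
and `θ(w)` agree modulo `Δ_Θ^N` — the interface form of the character constraint behind abc-iut-w5-d165's model-side
cusp obstructions (a section fixing its cusp inertia pointwise forces `χ_N ≡ 1` on `θ(w)` for every `N`).
[cite: MochizukiEtTh2009, Def 2.1 p.35] -/
theorem IsTateOrigin.pow_eq_pow_mul_of_centralises (hO : D.IsEtThOrigin)
    (hYcl : (D.DtpY.map D.toHat.toMonoidHom).topologicalClosure ≤
      D.DtpY.map D.toHat.toMonoidHom ⊔ (⁅⁅D.DeltaHat, D.DeltaHat⁆, D.DeltaHat⁆).topologicalClosure)
    (hT : D.IsTateOrigin) (hR2 : ∀ N : ℕ+, GtpYNFromCusp D N) {Dc : Subgroup D.PiTemp}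
    (hDc : D.IsCuspidalDecompositionGroup Dc) (hDcY : Dc ≤ D.GtpY) (N : ℕ+) {ζ : PadicAlgCl p}
    (hζ : IsPrimitiveRoot ζ (N : ℕ)) {σ : D.PiTemp} {k : ℕ} (hσ : D.aug σ ζ = ζ ^ k)
    {w : D.PiTemp} (hw : w ∈ Dc ⊓ D.DeltaTemp) (hcent : σ * w * σ⁻¹ = w) :
    ∃ e ∈ D.DeltaTheta, D.toTheta w = e ^ (N : ℕ) * D.toTheta w ^ k := by
  obtain ⟨e, he, h⟩ := hT.conj_inertia_tateTwist hO hYcl hR2 hDc hDcY N hζ σ hσ hw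
  exact ⟨e, he, by rw [← h, hcent]⟩

end ThetaSetting

end Literature.AnabelianGeometry.EtaleTheta

end
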